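import Mathlib.Data.Finsupp.Encodable
import Literature.Computability.MetaComplexity.RandReductions
import Literature.Computability.Complexity.RandomizedProofs
import Literature.Computability.Complexity.BPPErrorReduction
import Literature.Computability.Complexity.PolyTimeCountable
import HarnessLib

/-!
# Randomized reductions: the coin-length leak of `PolyTimeRandReducible`

Sibling file of `RandReductions.lean` (trunk CplxMeta) recording, with proofs, why its named fact
`mem_BPP_of_polyTimeRandReducible` — Arora–Barak 2009, §7.6, the remark after Def. 7.16 (p. 138):
"if `C ∈ BPP` and `B ≤ᵣ C`, then `B ∈ BPP`" — is MIS-STATED in the vendored model and cannot be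
discharged (D-0014). The corrected statement `mem_BPP_of_polyTimeRandReducible'` and its proof are
in `RandReductionsBPPProofs.lean`.

**The leak.** `RandAlg.IsPolyTime` (`Randomized.lean`) only *bounds* the coin budget
`A.coinLen : ℕ → ℕ`, an arbitrary — possibly non-computable — function, while `A.pr` runs `A` on
coin strings of length *exactly* `coinLen |x|`, a quantity `A.run` can read off its coin string.
The algorithm `leakAlg S` (`run x r := ⟨x, r⟩`, the identity machine; `coinLen n := [n ∈ S] ≤ 1`)
is therefore probabilistic polynomial time (`leakAlg_isPolyTime`) and reduces the language
`lengthSet S = {x | |x| ∈ S}` to the odd-length strings `oddLength` with probability `1`, for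
**every** `S ⊆ ℕ` — in the sense of `PolyTimeRandReducible` (`polyTimeRandReducible_lengthSet`)
and of the one-sided `PolyTimeRPReducible` (`polyTimeRPReducible_lengthSet`). The odd-length strings
are in `P` (`oddLength_mem_P`, by the two-state *length-parity* transducer `lengthParityT` —
not the bit-parity transducer `Complexity.parityT` of `TruthTableClosure.lean` — and
`FST.polyTimeComputable_eval`, `Transducers.lean`), hence in `BPP` (`P_subset_BPP_holds`), so the
named fact would put every `lengthSet S` — `2^ℵ₀` languages — into
the countable class `BPP` (`lengthSet_mem_BPP_of_mem_BPP_of_polyTimeRandReducible`): it is false in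
the standard model, and its in-file consequence `NP_subset_BPP_of_isRandNPHard_of_mem_BPP` is
vacuous. In the source there is no coin-length function: a probabilistic TM flips one coin per
step within its running time (Def. 7.1), equivalently reads `r ∈ {0,1}^{p(|x|)}` for a *polynomial*
`p` (Def. 7.3) — the exact-polynomial budget clause of `mem_BPP_iff_randAlg`
(`ProbabilisticClasses.lean`), `PromiseRandReducible` (`PromiseRandReductions.lean`) and
`PolyTimeRandReducible'` (`RandReductionsBPPProofs.lean`).

**The refutation.** The last section makes "false in the standard model" a theorem:
`not_mem_BPP_of_polyTimeRandReducible : ¬ mem_BPP_of_polyTimeRandReducible`. The class `P` is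
countable (`countable_P`: "machines as strings", `countable_setOf_polyTimeComputable` of
`PolyTimeCountable.lean` — the languages decided by Mathlib's `FinTM2` machines in polynomial time,
through the injection `L ↦ [· ∈ L]`), hence so is `BPP = bp P` (`countable_BPP`: a witness
`(L', p) ∈ P × ℕ[X]` determines the language, the two `2/3`-conditions being incompatible), while
`S ↦ lengthSet S` is injective on the uncountable type `Set ℕ` (`lengthSet_injective`, Cantor:
`Function.cantor_surjective`).

## References

* S. Arora, B. Barak, *Computational Complexity: A Modern Approach*, CUP 2009
  (doi:10.1017/cbo9780511804090): §7.6, Def. 7.16 and the remark following it (p. 138);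
  Def. 7.1 (p. 125, PTM: one coin per step, halts within `T(|x|)` steps), Def. 7.3 (p. 126,
  `M(x, r)`, `r ∈ {0,1}^{p(|x|)}`); Def. 1.13 (the class `P`).
* J. Gill, *Computational complexity of probabilistic Turing machines*, SIAM J. Comput. 6 (1977),
  §2 ("polynomial time on every input and every coin sequence").
-/

namespace Literature.Computability.MetaComplexity

open _root_.Computability Complexity

/-! ### The odd-length strings are in `P` -/

/-- The language of bit strings of odd length (`|y| mod 2 = 1`, via `Nat.bodd`), the target of
the leak reductions below. [folklore] -/
def oddLength : Language Bool :=
  {y | y.length.bodd = true}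

/-- Membership in `oddLength` (definitional). [folklore] -/
theorem mem_oddLength_iff (y : List Bool) : y ∈ oddLength ↔ y.length.bodd = true :=
  Iff.rfl

/-- The length-parity transducer: two states (the parity of the number of symbols read so far),
no output per symbol, and the final state emitted at the end; it computes `y ↦ [|y| mod 2]`.
(Named apart from `Complexity.parityT` of `TruthTableClosure.lean`, the parity of the number of
ones.) [Hopcroft–Ullman 1979, §2.7 (Moore machines); Arora–Barak 2009, §1.2] [folklore] -/
def lengthParityT : FST Bool Bool Bool where
  init := false
  step s _ := (!s, [])
  front s := [s]
  keep _ := false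

/-- One step of the length-parity transducer flips the state and emits nothing (definitional).
[folklore] -/
@[simp] theorem lengthParityT_step (s a : Bool) : lengthParityT.step s a = (!s, []) := rfl

/-- Running the length-parity transducer from state `s` on `l` ends in state `s ⊕ (|l| mod 2)`
with an empty body. [folklore] -/
theorem lengthParityT_run (s : Bool) (l : List Bool) :
    lengthParityT.run s l = (xor s l.length.bodd, []) := by
  induction l generalizing s with
  | nil => simp
  | cons a l ih =>
    rw [FST.run_cons, lengthParityT_step]
    dsimp only
    rw [ih, List.length_cons, Nat.bodd_succ, List.nil_append]
    cases s <;> cases l.length.bodd <;> rfl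

/-- The length-parity transducer computes `l ↦ [|l| mod 2]`. [folklore] -/
theorem lengthParityT_eval (l : List Bool) : lengthParityT.eval l = [l.length.bodd] := by
  rw [FST.eval, lengthParityT_run]
  simp [lengthParityT]

/-- **The odd-length strings are in `P`** (the length-parity transduction, linear time:
`FST.polyTimeComputable_eval`, `Transducers.lean`). [Arora–Barak 2009, Def. 1.13 and §1.2]
[cite: AroraBarakCC2009, Def. 1.13] -/
theorem oddLength_mem_P : oddLength ∈ Classes.P := by
  refine mem_P_iff_holds.2 (polyTimeDecidable_iff.2 ?_)
  refine PolyTimeComputable.of_encode_eq (f := lengthParityT.eval)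
    (ea := (id : List Bool → List Bool)) (eb := (id : List Bool → List Bool))
    (id : List Bool → List Bool) (fun _ => rfl) (fun l => ?_) lengthParityT.polyTimeComputable_eval
  show lengthParityT.eval l = [oddLength.boolIndicator l]
  rw [lengthParityT_eval]
  congr 1
  by_cases h : l ∈ oddLength
  · rw [(Set.mem_iff_boolIndicator _ _).1 h]
    exact h
  · rw [(Set.notMem_iff_boolIndicator _ _).1 h]
    cases hb : l.length.bodd
    · rfl
    · exact absurd hb h

/-! ### The leak algorithm -/

/-- The language of the strings whose *length* lies in `S ⊆ ℕ` (a "unary" encoding of `S`); there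
are `2^ℵ₀` of them. [folklore] -/
def lengthSet (S : Set ℕ) : Language Bool :=
  {x | x.length ∈ S}

/-- Membership in `lengthSet S` (definitional). [folklore] -/
theorem mem_lengthSet_iff (S : Set ℕ) (x : List Bool) : x ∈ lengthSet S ↔ x.length ∈ S :=
  Iff.rfl

open scoped Classical in
/-- **The leak algorithm** of a set `S ⊆ ℕ` of input lengths: output the machine input `⟨x, r⟩`
itself (the identity machine), with coin budget `[n ∈ S] ∈ {0, 1}` on inputs of length `n`. Its
budget is bounded (by `1`) but in general not computable — admissible for `RandAlg.IsPolyTime`,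
which only bounds the budget. [folklore] -/
noncomputable def leakAlg (S : Set ℕ) : RandAlg (List Bool) (List Bool) where
  run x r := boolPair x r
  coinLen n := if n ∈ S then 1 else 0

/-- The leak algorithm uses at most one coin. [folklore] -/
theorem leakAlg_coinLen_le_one (S : Set ℕ) (n : ℕ) : (leakAlg S).coinLen n ≤ 1 := by
  unfold leakAlg
  dsimp only
  split_ifs <;> simp

/-- The leak algorithm is probabilistic polynomial time in the sense of `RandAlg.IsPolyTime`:
its run map read through the pairing is the identity on strings (Mathlib's
`Turing.idComputableInPolyTime`), and its budget is bounded by the constant polynomial `1`.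
[Gill 1977, §2; Arora–Barak 2009, §1.2] [folklore] -/
theorem leakAlg_isPolyTime (S : Set ℕ) :
    (leakAlg S).IsPolyTime id (id : List Bool → List Bool) := by
  refine ⟨?_, 1, fun n => by simpa using leakAlg_coinLen_le_one S n⟩
  exact PolyTimeComputable.of_encode_eq (f := (id : List Bool → List Bool))
    (ea := (id : List Bool → List Bool)) (eb := (id : List Bool → List Bool))
    (fun p : List Bool × List Bool => boolPair p.1 p.2) (fun _ => rfl) (fun _ => rfl)
    (PolyTimeComputable.id (id : List Bool → List Bool))

/-- On a coin string of the prescribed length `[|x| ∈ S]` the output `⟨x, r⟩` of the leak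
algorithm has length `2|x| + 2 + [|x| ∈ S]`, which is odd iff `|x| ∈ S`. [folklore] -/
theorem leakAlg_run_mem_oddLength_iff (S : Set ℕ) (x : List Bool) {r : List Bool}
    (hr : r.length = (leakAlg S).coinLen x.length) :
    (leakAlg S).run x r ∈ oddLength ↔ x.length ∈ S := by
  show (boolPair x r).length.bodd = true ↔ x.length ∈ S
  rw [length_boolPair]
  simp only [leakAlg] at hr
  split_ifs at hr with hx
  · simp [Nat.bodd_mul, hr, hx]
  · simp [Nat.bodd_mul, hr, hx]

/-- The verdict "`|output|` odd `↔ |x| ∈ S`" of the leak algorithm holds with probability `1`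
(every sampled coin string has the prescribed length). [folklore] -/
theorem leakAlg_pr_verdict (S : Set ℕ) (x : List Bool) :
    (leakAlg S).pr id x {y : List Bool | y ∈ oddLength ↔ x.length ∈ S} = 1 := by
  rw [RandAlg.pr_eq_uniformProb, uniformProb_eq_cnt_div, cnt_eq_two_pow_of_forall,
    Nat.cast_pow, Nat.cast_ofNat, div_self (by positivity)]
  intro r hr
  exact leakAlg_run_mem_oddLength_iff S x hr

/-- On `|x| ∈ S` every sampled output of the leak algorithm has odd length. [folklore] -/
theorem leakAlg_pr_oddLength_of_mem (S : Set ℕ) {x : List Bool} (hx : x.length ∈ S) :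
    (leakAlg S).pr id x {y : List Bool | y ∈ oddLength} = 1 := by
  rw [RandAlg.pr_eq_uniformProb, uniformProb_eq_cnt_div, cnt_eq_two_pow_of_forall,
    Nat.cast_pow, Nat.cast_ofNat, div_self (by positivity)]
  intro r hr
  exact (leakAlg_run_mem_oddLength_iff S x hr).2 hx

/-- On `|x| ∉ S` no sampled output of the leak algorithm has odd length. [folklore] -/
theorem leakAlg_pr_oddLength_of_not_mem (S : Set ℕ) {x : List Bool} (hx : x.length ∉ S) :
    (leakAlg S).pr id x {y : List Bool | y ∈ oddLength} = 0 := by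
  rw [RandAlg.pr_eq_uniformProb, uniformProb_eq_cnt_div, div_eq_zero_iff]
  left
  have h0 : cnt ((leakAlg S).coinLen (id x).length)
      {r : List Bool | (leakAlg S).run x r ∈ {y : List Bool | y ∈ oddLength}} = 0 := by
    by_contra hne
    obtain ⟨r, hr, hrE⟩ := (cnt_pos_iff _ _).1 (Nat.pos_of_ne_zero hne)
    exact hx ((leakAlg_run_mem_oddLength_iff S x hr).1 hrE)
  exact_mod_cast h0

/-! ### Every set of input lengths reduces to the odd-length strings -/

/-- **The coin-length leak of `PolyTimeRandReducible`.** For every set `S ⊆ ℕ`, the language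
`lengthSet S = {x | |x| ∈ S}` reduces to the odd-length strings in the sense of
`PolyTimeRandReducible` (`RandReductions.lean`), by the leak algorithm, with success probability
`1`. There are `2^ℵ₀` such languages but only countably many genuine polynomial-time probabilistic
machines (Arora–Barak, Def. 7.1/7.3), so `PolyTimeRandReducible` is not Arora–Barak's `≤ᵣ`
(Def. 7.16): the bounded-but-arbitrary coin budget of `RandAlg.IsPolyTime` leaks the non-uniform
bit `[|x| ∈ S]`. [folklore] -/
theorem polyTimeRandReducible_lengthSet (S : Set ℕ) :
    PolyTimeRandReducible (lengthSet S) oddLength := by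
  refine ⟨leakAlg S, leakAlg_isPolyTime S, fun x => ?_⟩
  show 2 / 3 ≤ (leakAlg S).pr id x {y : List Bool | y ∈ oddLength ↔ x.length ∈ S}
  rw [leakAlg_pr_verdict]
  norm_num

/-- The same leak for the one-sided notion `PolyTimeRPReducible`: on `|x| ∈ S` every sampled
output is of odd length, on `|x| ∉ S` none is. [folklore] -/
theorem polyTimeRPReducible_lengthSet (S : Set ℕ) :
    PolyTimeRPReducible (lengthSet S) oddLength := by
  refine ⟨leakAlg S, leakAlg_isPolyTime S, fun x hx => ?_, fun x hx => ?_⟩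
  · rw [leakAlg_pr_oddLength_of_mem S (show x.length ∈ S from hx)]
    norm_num
  · exact leakAlg_pr_oddLength_of_not_mem S (show x.length ∉ S from hx)

/-- **`mem_BPP_of_polyTimeRandReducible` is mis-stated**: it would put `lengthSet S` into `BPP`
for *every* `S ⊆ ℕ` (the odd-length strings are in `P ⊆ BPP`: `oddLength_mem_P`,
`P_subset_BPP_holds`), i.e. `2^ℵ₀` languages into a countable class — false in the standard
model, so the named fact cannot be discharged (and its consequence
`NP_subset_BPP_of_isRandNPHard_of_mem_BPP` is vacuous). The corrected statement, with Arora–Barak's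
exact-polynomial coin budget, is `mem_BPP_of_polyTimeRandReducible'`
(`RandReductionsBPPProofs.lean`, proved there). [folklore] -/
theorem lengthSet_mem_BPP_of_mem_BPP_of_polyTimeRandReducible
    (h : mem_BPP_of_polyTimeRandReducible) (S : Set ℕ) : lengthSet S ∈ BPP :=
  h (polyTimeRandReducible_lengthSet S) (P_subset_BPP_holds oddLength_mem_P)

/-! ### Refutation: `P` and `BPP` are countable, the languages `lengthSet S` are not -/

/-- `ℕ[X]` is countable (finitely supported coefficient functions; the same one-liner as
`QuantumComplexity.countable_polynomial_nat`, not importable here). [folklore] -/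
private theorem countable_polynomial_nat_aux : Countable (Polynomial ℕ) :=
  (AddMonoidAlgebra.coeff_injective.comp Polynomial.toFinsupp_injective).countable

/-- **`P` is countable** ("every Turing machine can be represented as a string"): the indicator
`L ↦ [· ∈ L]` maps `P` injectively (`mem_P_iff_holds`) into the set of polynomial-time computable
Boolean-valued functions on `{0,1}*`, which is countable for Mathlib's machine model
(`countable_setOf_polyTimeComputable`, `PolyTimeCountable.lean`: reduction of `FinTM2` machines to
standard machines over `Fin _`). [Arora–Barak 2009, §1.4 (machines as strings)]
[cite: AroraBarakCC2009, §1.4] -/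
theorem countable_P : (Classes.P : Set (Language Bool)).Countable := by
  have h : Set.Countable
      {f : List Bool → Bool | PolyTimeComputable (id : List Bool → List Bool) encodeBool f} :=
    countable_setOf_polyTimeComputable (id : List Bool → List Bool)
      (Function.LeftInverse.injective decode_encodeBool)
  refine Set.MapsTo.countable_of_injOn (f := fun L : Language Bool => Set.boolIndicator L)
    (fun L hL => ?_) ?_ h
  · exact polyTimeDecidable_iff.1 (mem_P_iff_holds.1 hL)
  · intro L _ L' _ hLL'
    refine Language.ext fun x => ?_
    have h₁ : x ∈ L ↔ Set.boolIndicator L x = true := Set.mem_iff_boolIndicator L x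
    have h₂ : x ∈ L' ↔ Set.boolIndicator L' x = true := Set.mem_iff_boolIndicator L' x
    rw [h₁, h₂, show Set.boolIndicator L = Set.boolIndicator L' from hLL']

/-- **`BPP` is countable**: a `bp P` witness `(L', p)` — `L' ∈ P`, coin polynomial `p` —
determines the language it witnesses (at every `x` the condition "`≥ 2/3` of the coin strings give
the verdict `[⟨x,y⟩ ∈ L'] = [x ∈ L]`" holds for at most one value of `[x ∈ L]`,
`uniformProb_compl`), so `BPP` lies in the image of the countable set `P × ℕ[X]` (`countable_P`).
[Arora–Barak 2009, §1.4 and Def. 7.3; Gill 1977, §5 (enumeration of probabilistic machines)]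
[cite: AroraBarakCC2009, §1.4] -/
theorem countable_BPP : (BPP : Set (Language Bool)).Countable := by
  haveI : Countable (Polynomial ℕ) := countable_polynomial_nat_aux
  let g : Language Bool × Polynomial ℕ → Language Bool := fun D =>
    {x | 2 / 3 ≤ uniformProb (D.2.eval x.length) {y : List Bool | boolPair x y ∈ D.1}}
  have hcov : (BPP : Set (Language Bool)) ⊆ g '' (Classes.P ×ˢ Set.univ) := by
    rintro L ⟨L', hL', p, hp⟩
    refine ⟨(L', p), ⟨hL', Set.mem_univ _⟩, Language.ext fun x => ?_⟩
    show 2 / 3 ≤ uniformProb (p.eval x.length) {y : List Bool | boolPair x y ∈ L'} ↔ x ∈ L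
    have h := hp x
    by_cases hx : x ∈ L
    · have hset : {y : List Bool | boolPair x y ∈ L' ↔ x ∈ L} = {y | boolPair x y ∈ L'} := by
        ext y
        simp [hx]
      rw [hset] at h
      exact ⟨fun _ => hx, fun _ => h⟩
    · have hset : {y : List Bool | boolPair x y ∈ L' ↔ x ∈ L} = {y | boolPair x y ∈ L'}ᶜ := by
        ext y
        simp [hx]
      rw [hset, uniformProb_compl] at h
      exact ⟨fun h' => absurd h' (by linarith), fun h' => absurd h' hx⟩
  exact ((countable_P.prod Set.countable_univ).image g).mono hcov

/-- `S ↦ lengthSet S` is injective (test the string `0ⁿ`). [folklore] -/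
theorem lengthSet_injective : Function.Injective lengthSet := by
  intro S S' h
  ext n
  have h₁ : List.replicate n false ∈ lengthSet S ↔ List.replicate n false ∈ lengthSet S' := by
    rw [h]
  simpa [mem_lengthSet_iff] using h₁

/-- **`mem_BPP_of_polyTimeRandReducible` is false** (the vendored fact of `RandReductions.lean`,
as stated — not Arora–Barak's remark, whose faithful form `mem_BPP_of_polyTimeRandReducible'` is
proved in `RandReductionsBPPProofs.lean`): it would put `lengthSet S ∈ BPP` for every `S ⊆ ℕ`
(`lengthSet_mem_BPP_of_mem_BPP_of_polyTimeRandReducible`), an injective family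
(`lengthSet_injective`) indexed by the uncountable type `Set ℕ` (Cantor,
`Function.cantor_surjective`), inside the countable class `BPP` (`countable_BPP`). [folklore] -/
theorem not_mem_BPP_of_polyTimeRandReducible : ¬ mem_BPP_of_polyTimeRandReducible := by
  intro h
  have huniv : (Set.univ : Set (Set ℕ)).Countable :=
    Set.MapsTo.countable_of_injOn (f := lengthSet)
      (fun S _ => lengthSet_mem_BPP_of_mem_BPP_of_polyTimeRandReducible h S)
      lengthSet_injective.injOn countable_BPP
  haveI : Countable (Set ℕ) := Set.countable_univ_iff.1 huniv
  obtain ⟨f, hf⟩ := exists_surjective_nat (Set ℕ)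
  exact Function.cantor_surjective f hf

end Literature.Computability.MetaComplexity
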